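import Literature.MathematicalPhysics.QuantumFieldTheory.Balaban1983to89.B10RunsOfRecord
import Literature.MathematicalPhysics.QuantumFieldTheory.Balaban1983to89.T4AveragingDisintegration
import Literature.MathematicalPhysics.QuantumFieldTheory.Balaban1983to89.Node00.Record9

/-!
# NODE 00 (YM-PLAN Track A) — STAGE 4 «X.B10» OF THE CARRIERS OF RECORD: the [Balaban1985UV3] group of the residual carrier
# bundle PINNED to print's d = 3 run family on SU(N) (`B10RunsOfRecord`), the transformation of that family chosen by the
# printed theorems (chair R434 (c2)'s `Classical.choose` idiom applied to the a.e.-class of (2)), the CARRIER PIN as an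
# UP-SIDE modification of Stage-5 parameters (it commutes with every machine stage ₅ ∕ ₇ ∕ ₈ ∕ ₉: the datum does not read the
# carriers), and the record predicates `IsRecordOfRecord₉CB10 ∕ ₈CB10` refining `IsRecordOfRecord₉C ∕ ₈C`, with N08's exact face

NODE 00 CARRIER MODULE (seat `pub-ymgap-node00-def` g29, 2026-08-26; APPEND-ONLY growth: a NEW importing module; `Record5 ∕ 5C ∕ 7 ∕ 8`,
`B10RunsOfRecord` untouched).  Design word Q5∕Q6 of dag-n08-a's `N08-STAGE4-READING-NOTE.md` (whose §3 objects this file CONSUMES BY NAME: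
`withRuns10`, `Backgrounds.ofPrint`, `runObjects₀T`, `PrintedUV3G`, `constsOfRecordG`, `runsOfRecordG`, `b10Compact_withRuns10_runsOfRecordG_iff`).

WHAT IS PINNED HERE.  In `Residual₅.X P : PrintedCarriersR` the B10 group (`I10`, `runs10`) was free DATA; at a record in the sense of this module it IS
print's run family `B10RunsOfRecord.runsOfRecordG N (runObjects₀T N (tOfRecord₃ N L) (Backgrounds.ofPrint N L))` on SU(N) with Bałaban's block size
`L = θ.L`: every lattice approximation of [Balaban1985UV3] p. 256 (all couplings, spacings, volumes; terminal spacing `ε₀(g)`), print's averaging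
(2) = [Balaban1985Averaging] (15), the [Balaban1985Variational] minimisers in def-B's idiom of record (`Backgrounds.ofPrint`), the constants
`ε₀(·), E, b₀, p₀, εbg` chosen by the printed existential (`constsOfRecordG`), and — the one design word of this file — the renormalization
transformations `T` of (2) read as THE VERSION CHOSEN BY THE PRINTED THEOREMS (`tOfRecord₃`, §1): print defines `T` by the δ-function formula
[Balaban1985Averaging] (10), which the tree reads as the push-forward identity `Setup.IsRT` — an a.e.-CLASS of densities, all of whose versions
(`Setup.RTOpI` inhabitants along print's averaging: the Radon–Nikodym transport `B10RunsOfRecord.TOfPrint`, the disintegration-kernel transport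
`tKernelOfPrint` of this file, …) agree `dV`-a.e. on integrable densities; the printed bounds (5), (41), (47) are POINTWISE («for all U»), hence
statements about a VERSION; over any FIXED version picked by `Classical.choice` inside Mathlib (`rnDeriv`, `condKernel`) they are reachable by no
witness (dag-n13-b's STAGE7-POINTWISE certificate, chair R437 (d), dag-n08-a's [N08-A-G3-T6-CAVEAT]).  The slot of record is therefore
`PrintedUV3V N L := ∃ 𝔗, PrintedUV3G N L (runObjects₀T N 𝔗 (Backgrounds.ofPrint N L))` — «SOME version of print's transformations carries Thm 1
(compact reading) ∧ Thm 2 with their printed ∃-prefix» (⟸ the printed pointwise theorems for the δ-formula's continuous fibre integrals; ⟹ their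
a.e. reading for every version — a READING, stated, not proved here) —, the transformation of record is a version witnessing it when one exists (else the kernel transport), and
the KERNEL FACT `b10Compact (X.withRuns10 (runsB10OfRecord N L)) ↔ PrintedUV3V N L` makes the `b10` leaf at every record of this module
EQUIVALENT to that slot (`leaf_b10_iff_of_isRecordOfRecord₉CB10`): not closable by junk, not refutable by junk.  COMPATIBILITY (def-T's
[ERRATUM-VERSION + INTENT-4], pub-ymgap INBOX l.10987): the kernel transport — here `tKernelOfPrint`, at d = 4 the Stage-9 `transportOfRecord` — is itself a
Mathlib-chosen version (`margDensity` is an `rnDeriv`, `condLaw` a `condKernel`), so its POINT VALUES are version values; the theorems hold at SOME version iff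
they hold at any a.e.-equal one modified on a null set, and in particular `PrintedUV3V` FOLLOWS from the printed theorems at the CONTINUOUS version
(`Node00/ContinuousTransportOfRecord`, when it lands) by ∃-introduction — the ε-branch of `tOfRecord₃` may then be re-pointed to that version in a successor
without touching the slot.

THE PIN IS UP-SIDE.  `Stage5Params.pinB10 θ` replaces `θ.res.X` only; the density tower, the machine, the datum are unchanged (`datumOfRecord₅_pinB10`),
the pinned parameters ARE Stage-5 (Stage-8) parameters, so a record of the pinned class is a record of the unpinned class WITH THE SAME WORLD and every world-reading node theorem transfers verbatim.  Hence the carrier pin COMMUTES with the machine stages: the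
same one-line recipe gives `IsRecordOfRecordₛCB10` over every machine-stage predicate `ₛ ∈ {5C, 7C, 8C, 9C}` (this file: `₉C` = the top of the chain
(`Node00/Record9.lean`, whose `Provisos` read no carrier either: `Stage9Params.Provisos.pinB10`) and `₈C`), and the carrier-pinning successor ₁₀C of the
design of record composes the pins of the remaining groups ([B8], [B9] = Y, [B11] = Z, B12, B13, [B15] = W; V is pinned at ₉ from the represented tower)
in the same way — one `Residual₅.pin…` per group, one `rfl` per stage view, one field-by-field transport of the provisos.
HONEST FRAMING: definitions + kernel bookkeeping; NO estimate; `PrintedUV3V` is TYPED, NOT PROVED ([Balaban1985UV3]'s content = the object gap of N08); N08 NOT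
discharged; counts unmoved; the d = 3 lattices of [B10] inside the d = 4 record; one finite torus per run at fixed spacing — NOT ℝ³ ∕ ℝ⁴ ∕ infinite volume ∕ OS ∕
mass gap ∕ Clay.  No `sorry`, no `axiom`, no `opaque`, no `instance`, no `notation`. -/

noncomputable section

open MeasureTheory

namespace Literature.MathematicalPhysics.QuantumFieldTheory.Balaban1983to89.Node00

open T4Continuum AveragingRT T4FiniteEpsInhabited FlowStep FlowStepRuns DagBinding T4DatumAssembly T4AveragingDisintegration
open Balaban1985CMP102 Balaban1985CMP102.Setting Balaban1985CMP102.Theorems B10RunsOfRecord B10Eq2DensityTower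
open B10CompactBinding (withB10 ofPrintedAllXPNC)
open DagDischarged (b10Compact)

/-! ## §1. The [B10] group's transformations on SU(N), d = 3: the kernel transport along print's averaging, the slot of record, the transformation of record -/

section Transformation

variable (N : ℕ) [NeZero N] {L : ℕ}

/-- **The disintegration-kernel transport along print's averaging** on the d = 3 lattices of `S`: in the standing range `j + 1 ≤ m + K` the ONE-KERNEL
transport `T4AveragingDisintegration.transportK` of [Balaban1985Averaging] (10) along Bałaban's exp-mean-log block averaging (15) on SU(N) (marginal density ×
conditional law of `U` given `Ū = V`; the mechanism of NODE 00's `transportOfRecord` at d = 4, read at d = 3), beyond it the transport operator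
`AveragingRT.rtOpIStd`; an `RTOpI` along `B10RunsOfRecord.avOfPrint N S j` at EVERY level (`isRT_kernelTransport` at the tree's bracket
`hac_expMeanLogSU_SUN`).  A VERSION of print's `T` (a.e.-equal to `TOfPrint`: `tKernelOfPrint_ae_eq_TOfPrint`). [cite: Balaban1985UV3, (2) p.256; Balaban1985Averaging, (10) + (15) p.19] -/
def tKernelOfPrint (S : Scales L) (j : ℕ) : RTOpI S.P j (SU N) (avOfPrint N S j) where
  T := if j + 1 ≤ S.P.m + S.P.K then
      transportK (BlockAveraging.avgFun ExpMeanLog.expMeanLogSU : GaugeField S.P j (SU N) → GaugeField S.P (j + 1) (SU N))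
    else (rtOpIStd S.P (SU N) j).T
  isRT := by
    intro ρ hρ
    by_cases hj : j + 1 ≤ S.P.m + S.P.K
    · rw [if_pos hj]
      show IsRT (blockAvgStd S.P (SU N) ExpMeanLog.expMeanLogSU j).avg ρ _
      rw [blockAvgStd_avg_of_le _ hj]
      exact isRT_kernelTransport (BlockAveraging.measurable_avgFun _ ExpMeanLog.measurable_expMeanLogSU_E)
        (hac_expMeanLogSU_SUN S.P j hj) ρ hρ
    · rw [if_neg hj]
      show IsRT (blockAvgStd S.P (SU N) ExpMeanLog.expMeanLogSU j).avg ρ _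
      rw [blockAvgStd_of_not_le _ hj]
      exact (rtOpIStd S.P (SU N) j).isRT ρ hρ
  pos := by
    intro ρ h0 V
    by_cases hj : j + 1 ≤ S.P.m + S.P.K
    · rw [if_pos hj]
      exact kernelTransport_nonneg h0 V
    · rw [if_neg hj]
      exact (rtOpIStd S.P (SU N) j).pos ρ h0 V

/-- In the standing range `tKernelOfPrint` IS the kernel transport along (15). [cite: Balaban1985Averaging, (10) p.19 (bookkeeping)] -/
theorem tKernelOfPrint_T_of_le (S : Scales L) {j : ℕ} (hj : j + 1 ≤ S.P.m + S.P.K) :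
    (tKernelOfPrint N S j).T =
      transportK (BlockAveraging.avgFun ExpMeanLog.expMeanLogSU : GaugeField S.P j (SU N) → GaugeField S.P (j + 1) (SU N)) := by
  show (if j + 1 ≤ S.P.m + S.P.K then _ else _) = _
  rw [if_pos hj]

/-- The kernel transport and print's Radon–Nikodym transport `TOfPrint` agree `dV`-a.e. on every integrable density, in the standing range (two versions of
one class: `kernelTransport_ae_eq_rnTransport`). [cite: Balaban1985Averaging, (10) p.19 (the δ-formula's a.e.-class; bookkeeping)] -/
theorem tKernelOfPrint_ae_eq_TOfPrint (S : Scales L) {j : ℕ} (hj : j + 1 ≤ S.P.m + S.P.K) (ρ : Density S.P j (SU N))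
    (hρ : Integrable ρ (fieldMeasure S.P j (SU N))) :
    (tKernelOfPrint N S j).T ρ =ᵐ[fieldMeasure S.P (j + 1) (SU N)] (TOfPrint N S j).T ρ := by
  rw [tKernelOfPrint_T_of_le N S hj]
  show _ =ᵐ[_] (rtOpIBlockAvgStd S.P (SU N) ExpMeanLog.expMeanLogSU ExpMeanLog.measurable_expMeanLogSU_E
    (hac_expMeanLogSU_SUN S.P) j).T ρ
  rw [rtOpIBlockAvgStd_T_of_le _ _ _ hj]
  exact kernelTransport_ae_eq_rnTransport (BlockAveraging.measurable_avgFun _ ExpMeanLog.measurable_expMeanLogSU_E)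
    (hac_expMeanLogSU_SUN S.P j hj) ρ hρ

variable (L) in
/-- **A VERSION FAMILY of print's transformations (2)**: per lattice approximation and level, a renormalization transform along print's averaging in the
cell's sense `Setup.RTOpI` (push-forward identity on integrable densities + positivity).  All inhabitants agree `dV`-a.e. on integrable densities
(`T4AveragingDisintegration.ae_eq_of_forall_integral_mul_eq`). [cite: Balaban1985UV3, (2) p.256; Balaban1985Averaging, (10) p.19] -/
abbrev TFamily₃ : Type := ∀ S : Scales L, ∀ j, RTOpI S.P j (SU N) (avOfPrint N S j)

variable (L) in
/-- **THE [B10] SLOT OF RECORD — [Balaban1985UV3] Thm 1 (compact reading) ∧ Thm 2 WITH THEIR PRINTED ∃-PREFIX, AT SOME VERSION of print's transformations**,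
on SU(N) with print's averaging and print's own [B11]-minimisers: `∃ 𝔗, B10RunsOfRecord.PrintedUV3G N L (runObjects₀T N 𝔗 (Backgrounds.ofPrint N L))`.  READING
(this file's design word): the printed bounds (5) ∕ (41) ∕ (47) are pointwise in the field, i.e. about a version of the a.e.-class (10); the slot asks them
of SOME version (⟸ print's statement for the continuous fibre integrals of (10); ⟹ the a.e. reading for every version).  TYPED, NOT ASSERTED — this
Prop is the object gap of node N08. [cite: Balaban1985UV3, Thm 1 p.257, Thm 2 p.272; Balaban1985Averaging, (10) p.19] -/
def PrintedUV3V : Prop :=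
  ∃ 𝔗 : TFamily₃ N L, PrintedUV3G N L (runObjects₀T N 𝔗 (Backgrounds.ofPrint N L))

variable (L) in
/-- **THE TRANSFORMATIONS OF RECORD of the [B10] group**: a version of (2) CHOSEN BY THE PRINTED THEOREMS when one carries them (`Classical.choose`, chair
R434 (c2)'s idiom applied to the version), else the kernel transport `tKernelOfPrint`. [cite: Balaban1985UV3, (2) p.256, Thm 1 p.257, Thm 2 p.272] -/
def tOfRecord₃ : TFamily₃ N L := by
  classical
  exact if h : PrintedUV3V N L then Classical.choose h else tKernelOfPrint N

/-- KERNEL FACT: the printed theorems hold at the transformations of record IFF they hold at some version (`Q x₀ ↔ ∃ x, Q x` for the ε-idiom).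
[cite: Balaban1985UV3, Thm 1 p.257, Thm 2 p.272 (bookkeeping over the printed existential)] -/
theorem printedUV3G_tOfRecord₃_iff :
    PrintedUV3G N L (runObjects₀T N (tOfRecord₃ N L) (Backgrounds.ofPrint N L)) ↔ PrintedUV3V N L := by
  classical
  refine ⟨fun h => ⟨tOfRecord₃ N L, h⟩, fun h => ?_⟩
  unfold tOfRecord₃
  rw [dif_pos h]
  exact Classical.choose_spec h

variable (L) in
/-- **THE [B10] RUN FAMILY OF RECORD** on SU(N) with block size `L`: print's run family over the binders `runObjects₀T N (tOfRecord₃ N L) (Backgrounds.ofPrint N L)`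
at the constants chosen by the printed existential (`B10RunsOfRecord.runsOfRecordG`). [cite: Balaban1985UV3, (1)–(5) p.256, p.256 L15–18] -/
def runsB10OfRecord :
    Family L (constsOfRecordG N (runObjects₀T N (tOfRecord₃ N L) (Backgrounds.ofPrint N L))).eps0 → B10.RunData :=
  runsOfRecordG N (runObjects₀T N (tOfRecord₃ N L) (Backgrounds.ofPrint N L))

/-- **`b10Compact (X.withRuns10 (runsB10OfRecord N L)) ↔ PrintedUV3V N L`** — the compact node over carriers whose B10 group is the run family of record IS the
slot of record (dag-n08-a's `b10Compact_withRuns10_runsOfRecordG_iff` + `printedUV3G_tOfRecord₃_iff`). [cite: Balaban1985UV3, Thm 1 p.257 (compact reading) + Thm 2 p.272] -/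
theorem b10Compact_withRuns10_runsB10OfRecord_iff (X : PrintedCarriersR) :
    b10Compact (X.withRuns10 (runsB10OfRecord N L)).toPrintedCarriers ↔ PrintedUV3V N L :=
  (b10Compact_withRuns10_runsOfRecordG_iff N _ X).trans (printedUV3G_tOfRecord₃_iff N)

/-- The run family of record is indexed by an inhabited type, for every odd `L > 1`. [cite: Balaban1985UV3, p.256 L15–18 (bookkeeping)] -/
theorem runsB10OfRecord_index_nonempty (hL : Odd L ∧ 1 < L) :
    Nonempty (Family L (constsOfRecordG N (runObjects₀T N (tOfRecord₃ N L) (Backgrounds.ofPrint N L))).eps0) :=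
  family_constsOfRecordG_nonempty N _ hL

end Transformation

/-! ## §2. The carrier pin on Stage-5 parameters (UP-SIDE: the datum does not read it) -/

section Pin

variable (F : T4Family) (N : ℕ) [NeZero N]

/-- **The B10 pin of a Stage-5 residual** at block size `L`: the run-indexed carrier bundle `X P` with its B10 group := the run family of record (the same
family at every run `P` — [B10]'s lattices are its own); every other field of the residual unchanged. [cite: Balaban1985UV3, (1)–(5) p.256, Thm 1 p.257 + Thm 2 p.272 (the objects the leaf `b10` reads)] -/
def Residual₅.pinB10 (r : Residual₅ F N) (L : ℕ) : Residual₅ F N :=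
  { r with X := fun P => (r.X P).withRuns10 (runsB10OfRecord N L) }

/-- **The B10 pin of Stage-5 parameters**: the residual's B10 group pinned at Bałaban's block size `θ.L`. [cite: Balaban1985UV3, (1)–(5) p.256 (objects of record, Stage 4 «X.B10»)] -/
def Stage5Params.pinB10 (θ : Stage5Params F N) : Stage5Params F N :=
  { θ with res := θ.res.pinB10 F N θ.L }

/-- The pinned carrier family, unfolded (`rfl`). [cite: Balaban1985UV3, (1)–(5) p.256 (bookkeeping)] -/
theorem Stage5Params.pinB10_X (θ : Stage5Params F N) (P : B12.RunParams) :
    (θ.pinB10 F N).res.X P = (θ.res.X P).withRuns10 (runsB10OfRecord N θ.L) := rfl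

/-- The pin does not touch the Stage-3 dictionary (`rfl`). [cite: Balaban1984PropagatorsII, pp.223–250 (bookkeeping)] -/
theorem Stage5Params.pinB10_toStage3Params (θ : Stage5Params F N) : (θ.pinB10 F N).toStage3Params = θ.toStage3Params := rfl

/-- … nor the interval constant (`rfl`). [cite: Balaban1989LargeFieldII, Thm 1 p.355 (bookkeeping)] -/
theorem Stage5Params.pinB10_γ (θ : Stage5Params F N) : (θ.pinB10 F N).γ = θ.γ := rfl

/-- … nor admissibility (`Iff.rfl`). [cite: Balaban1983RegularityDecay, (1.6) p.572 (hypothesis dictionary; bookkeeping)] -/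
theorem Stage5Params.pinB10_admissible_iff (θ : Stage5Params F N) : (θ.pinB10 F N).Admissible ↔ θ.Admissible := Iff.rfl

/-- … nor the density tower (it reads the machine-side residual fields only; induction on `k`). [cite: Balaban1988Convergent, (0.2) p.244 (bookkeeping)] -/
theorem densOfRecord₅_pinB10 (θ : Stage5Params F N) (p : B12.RunParams) :
    ∀ k, densOfRecord₅ F N (θ.pinB10 F N) p k = densOfRecord₅ F N θ p k
  | 0 => rfl
  | k + 1 => by
    show θ.res.R p k (TrhoOfRecord F N p.K k (densOfRecord₅ F N (θ.pinB10 F N) p k)) =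
      θ.res.R p k (TrhoOfRecord F N p.K k (densOfRecord₅ F N θ p k))
    rw [densOfRecord₅_pinB10 θ p k]

/-- … nor the machine of the record. [cite: Balaban1988Convergent, (0.2) p.244 (bookkeeping)] -/
theorem machineOfRecord₅_pinB10 (θ : Stage5Params F N) : machineOfRecord₅ F N (θ.pinB10 F N) = machineOfRecord₅ F N θ := by
  unfold machineOfRecord₅
  simp only [densOfRecord₅_pinB10]
  rfl

/-- … nor, therefore, the assembled datum: THE CARRIER PIN IS UP-SIDE. [cite: Balaban1988Convergent, (0.2) p.244 (bookkeeping)] -/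
theorem datumOfRecord₅_pinB10 (θ : Stage5Params F N) : datumOfRecord₅ F N (θ.pinB10 F N) = datumOfRecord₅ F N θ := by
  unfold datumOfRecord₅
  rw [machineOfRecord₅_pinB10]

/-- **The `b10` leaf of the C-binding at pinned parameters IS the slot of record**: `(upOfRecord₅C (θ.pinB10) P).b10 ↔ PrintedUV3V N θ.L`.
[cite: Balaban1985UV3, Thm 1 p.257 (compact reading) + Thm 2 p.272] -/
theorem upOfRecord₅C_pinB10_b10_iff (θ : Stage5Params F N) (P : B12.RunParams) :
    (upOfRecord₅C F N (θ.pinB10 F N) P).b10 ↔ PrintedUV3V N θ.L := by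
  rw [upOfRecord₅C_b10_iff, Stage5Params.pinB10_toStage3Params, Stage5Params.pinB10_X]
  exact b10Compact_withRuns10_runsB10OfRecord_iff N (carriers₃ θ.toStage3Params (θ.res.X P))

end Pin

/-! ## §3. The Stage-8 record with the [B10] group pinned: `IsRecordOfRecord₈CB10`, its refinements, N08's exact face -/

section Record

variable (F : T4Family) (N : ℕ) [NeZero N]

/-- The B10 pin of Stage-8 parameters (the residual's B10 group at block size `θ.L`; every Stage-8 datum field untouched). [cite: Balaban1985UV3, (1)–(5) p.256 (bookkeeping)] -/
def Stage8Params.pinB10 (θ : Stage8Params F N) : Stage8Params F N :=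
  { θ with res := θ.res.pinB10 F N θ.L }

/-- Admissibility is unchanged by the pin (`Iff.rfl`). [cite: Balaban1987RG1, (0.21) p.256 (hypothesis dictionary; bookkeeping)] -/
theorem Stage8Params.pinB10_admissible_iff (θ : Stage8Params F N) : (θ.pinB10 F N).Admissible ↔ θ.Admissible := Iff.rfl

/-- The Stage-5 view of pinned Stage-8 parameters IS the pinned Stage-5 view (`rfl`: the Stage-8 substitutions read no carrier). [cite: Balaban1987RG1, (0.22) p.256 (bookkeeping)] -/
theorem Stage8Params.toStage5_pinB10 (θ : Stage8Params F N) :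
    (θ.pinB10 F N).toStage5 F N = (θ.toStage5 F N).pinB10 F N := rfl

/-- **«(D, w) is the record, Stage 8, [B10] group pinned»**: `IsRecordOfRecord₈C` VERBATIM except that the world's upstream block is the C-binding at the
PINNED Stage-5 view — the B10 group of the carriers IS print's d = 3 run family of record on SU(N) with block size `θ.L`. [cite: Balaban1985UV3, (1)–(5) p.256, Thm 1 p.257 + Thm 2 p.272; Balaban1987RG1, (0.17)–(0.24) pp.255–257; Balaban1989LargeFieldII, Thm 1 + (0.1) pp.355–356 (objects of record)] -/
def IsRecordOfRecord₈CB10 (D : FiniteEpsData F (SU N)) (w : WorldP) : Prop :=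
  ∃ θ : Stage8Params F N, θ.Admissible ∧ D = datumOfRecord₅ F N (θ.toStage5 F N) ∧ w.C = D.C ∧ (0 < w.γ ∧ w.γ ≤ θ.γ) ∧ w.L = (θ.L : ℝ) ∧
    ∀ P : B12.RunParams, w.up P = upOfRecord₅C F N ((θ.toStage5 F N).pinB10 F N) P

variable {F N}
variable {D : FiniteEpsData F (SU N)} {w : WorldP}

/-- **Refinement `IsRecordOfRecord₈CB10 → IsRecordOfRecord₈C`** (witness `θ.pinB10`: same datum by `datumOfRecord₅_pinB10`, same upstream block by
`toStage5_pinB10`). [cite: Balaban1985UV3, Thm 1 p.257 (bookkeeping)] -/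
theorem isRecordOfRecord₈C_of_isRecordOfRecord₈CB10 (h : IsRecordOfRecord₈CB10 F N D w) : IsRecordOfRecord₈C F N D w := by
  obtain ⟨θ, hθ, hD, hC, hγ, hL, hup⟩ := h
  refine ⟨θ.pinB10 F N, hθ, ?_, hC, hγ, hL, fun P => ?_⟩
  · rw [Stage8Params.toStage5_pinB10, datumOfRecord₅_pinB10]; exact hD
  · rw [Stage8Params.toStage5_pinB10]; exact hup P

/-- … hence to Stage 7 and to the record predicate of record `IsRecordOfRecord₅C`. [cite: Balaban1989LargeFieldI, (0.2) p.176 (bookkeeping)] -/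
theorem isRecordOfRecord₅C_of_isRecordOfRecord₈CB10 (h : IsRecordOfRecord₈CB10 F N D w) : IsRecordOfRecord₅C F N D w :=
  isRecordOfRecord₅C_of_isRecordOfRecord₈C (isRecordOfRecord₈C_of_isRecordOfRecord₈CB10 h)

/-- **THE `b10` LEAF AT A RECORD OF THIS MODULE IS THE SLOT OF RECORD**, at every run: `(leavesP w P).b10 ↔ PrintedUV3V N L` with `L` the world's (Bałaban's)
block size. [cite: Balaban1985UV3, Thm 1 p.257 (compact reading) + Thm 2 p.272] -/
theorem leaf_b10_iff_of_isRecordOfRecord₈CB10 (h : IsRecordOfRecord₈CB10 F N D w) :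
    ∃ L : ℕ, (Odd L ∧ 1 < L) ∧ w.L = (L : ℝ) ∧ ∀ P : B12.RunParams, (leavesP w P).b10 ↔ PrintedUV3V N L := by
  obtain ⟨θ, -, -, -, -, hL, hup⟩ := h
  refine ⟨θ.L, θ.hL, hL, fun P => ?_⟩
  show (w.up P).b10 ↔ _
  rw [hup P]
  exact upOfRecord₅C_pinB10_b10_iff F N (θ.toStage5 F N) P

/-- **N08 · [Balaban1985UV3] AT EVERY RECORD OF THIS MODULE, FROM THE SLOT OF RECORD** (in-edges unused): if for every odd `L > 1` some version of print's
transformations carries Thm 1 (compact) ∧ Thm 2 on SU(N), then `Dag.B10_main` holds at every run of every record.  The hypothesis is N08's object gap,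
nothing else. [cite: Balaban1985UV3, Thm 1 p.257 (compact reading) + Thm 2 p.272] -/
theorem b10_main_of_isRecordOfRecord₈CB10 (hUV : ∀ L : ℕ, Odd L → 1 < L → PrintedUV3V N L) (h : IsRecordOfRecord₈CB10 F N D w)
    (P : B12.RunParams) : Dag.B10_main (leavesP w P) := by
  obtain ⟨L, hL, -, hiff⟩ := leaf_b10_iff_of_isRecordOfRecord₈CB10 h
  exact fun _ _ _ _ _ _ => (hiff P).2 (hUV L hL.1 hL.2)

variable (F N) in
/-- **The constant-binding records of this module**: for admissible `θ`, the assembled datum at `θ` and ANY world re-bound to its construction, a window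
`]0, w.γ] ⊆ ]0, θ.γ]`, block size `θ.L` and the PINNED upstream block form a record. [cite: Balaban1985UV3, (1)–(5) p.256; Balaban1989LargeFieldII, Thm 1 + (0.1) pp.355–356 (objects of record, bookkeeping)] -/
theorem isRecordOfRecord₈CB10_of_eq (θ : Stage8Params F N) (hθ : θ.Admissible) (w : WorldP)
    (hC : w.C = (datumOfRecord₅ F N (θ.toStage5 F N)).C) (hγ : 0 < w.γ ∧ w.γ ≤ θ.γ) (hL : w.L = (θ.L : ℝ))
    (hup : ∀ P, w.up P = upOfRecord₅C F N ((θ.toStage5 F N).pinB10 F N) P) :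
    IsRecordOfRecord₈CB10 F N (datumOfRecord₅ F N (θ.toStage5 F N)) w :=
  ⟨θ, hθ, rfl, hC, hγ, hL, hup⟩

end Record

/-! ## §4. The Stage-9 record with the [B10] group pinned: `IsRecordOfRecord₉CB10` — the top of the record chain at filing -/

section Record9

variable (F : T4Family) (N : ℕ) [NeZero N]

/-- The B10 pin of Stage-9 parameters (the residual's B10 group at block size `θ.L`; every Stage-9 datum ∕ proviso field untouched). [cite: Balaban1985UV3, (1)–(5) p.256 (bookkeeping)] -/
def Stage9Params.pinB10 (θ : Stage9Params F N) : Stage9Params F N :=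
  { θ with res := θ.res.pinB10 F N θ.L }

/-- Admissibility is unchanged by the pin (`Iff.rfl`). [cite: Balaban1987RG1, (1.20)–(1.21) p.264 (hypothesis dictionary; bookkeeping)] -/
theorem Stage9Params.pinB10_admissible_iff (θ : Stage9Params F N) : (θ.pinB10 F N).Admissible ↔ θ.Admissible := Iff.rfl

/-- The Stage-5 view of pinned Stage-9 parameters IS the pinned Stage-5 view (`rfl`: `residualOfStage9`, incl. the pinned 𝐑-carriers `VOfRecord₉`, reads no
carrier of `X`). [cite: Balaban1988Convergent, p.244 (bookkeeping)] -/
theorem Stage9Params.toStage5_pinB10 (θ : Stage9Params F N) :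
    (θ.pinB10 F N).toStage5 F N = (θ.toStage5 F N).pinB10 F N := rfl

variable {F N} in
/-- The displayed provisos read no carrier: they transport ALONG the pin, field by field. [cite: Balaban1988Convergent, (3.2)–(3.9) pp.265–266; Balaban1989LargeFieldI, (0.3) p.176 (the displayed provisos; bookkeeping)] -/
theorem Stage9Params.Provisos.pinB10 {θ : Stage9Params F N} (h : θ.Provisos) : (θ.pinB10 F N).Provisos :=
  ⟨h.intPiece, h.measω, h.measChi, h.zetaUnity, h.zetaAbs, fun p k _ hk => h.rstep p k hk⟩

variable {F N} in
/-- … and BACK. [cite: Balaban1988Convergent, (3.2)–(3.9) pp.265–266 (bookkeeping)] -/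
theorem Stage9Params.Provisos.of_pinB10 {θ : Stage9Params F N} (h : (θ.pinB10 F N).Provisos) : θ.Provisos :=
  ⟨h.intPiece, h.measω, h.measChi, h.zetaUnity, h.zetaAbs, fun p k _ hk => h.rstep p k hk⟩

/-- THE PIN IS UP-SIDE at Stage 9 too: the datum of record of pinned parameters is the datum of record (`rfl`). [cite: Balaban1989LargeFieldII, Thm 1 + (0.1) pp.355–356 (bookkeeping)] -/
theorem datumOfRecord₉_pinB10 (θ : Stage9Params F N) (h : θ.Provisos) :
    datumOfRecord₉ F N (θ.pinB10 F N) (h.pinB10) = datumOfRecord₉ F N θ h := rfl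

/-- **«(D, w) is the record, Stage 9, [B10] group pinned»**: `IsRecordOfRecord₉C` VERBATIM except that the world's upstream block is the C-binding at the PINNED
Stage-5 view — the B10 group of the carriers IS print's d = 3 run family of record on SU(N) with block size `θ.L`; `W`, `Y`, `Z` and `X`'s [B8] ∕ B12 ∕ B13 groups
stay residual (the successor ₁₀C pins them). [cite: Balaban1985UV3, (1)–(5) p.256, Thm 1 p.257 + Thm 2 p.272; Balaban1989LargeFieldII, Thm 1 + (0.1) pp.355–356; Balaban1988Convergent, (2.18) p.257 (objects of record)] -/
def IsRecordOfRecord₉CB10 (D : FiniteEpsData F (SU N)) (w : WorldP) : Prop :=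
  ∃ (θ : Stage9Params F N) (h : θ.Provisos), θ.Admissible ∧ D = datumOfRecord₉ F N θ h ∧ w.C = D.C ∧ (0 < w.γ ∧ w.γ ≤ θ.γ) ∧
    w.L = (θ.L : ℝ) ∧ ∀ P : B12.RunParams, w.up P = upOfRecord₅C F N ((θ.toStage5 F N).pinB10 F N) P

/-- Pointed form. [cite: Balaban1989LargeFieldII, Thm 1 + (0.1) pp.355–356 (bookkeeping)] -/
theorem isRecordOfRecord₉CB10_of_eq (θ : Stage9Params F N) (h : θ.Provisos) (hθ : θ.Admissible) (w : WorldP)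
    (hC : w.C = (datumOfRecord₉ F N θ h).C) (hγ : 0 < w.γ ∧ w.γ ≤ θ.γ) (hL : w.L = (θ.L : ℝ))
    (hup : ∀ P, w.up P = upOfRecord₅C F N ((θ.toStage5 F N).pinB10 F N) P) :
    IsRecordOfRecord₉CB10 F N (datumOfRecord₉ F N θ h) w :=
  ⟨θ, h, hθ, rfl, hC, hγ, hL, hup⟩

/-- **Inhabitation is Stage 9's EXACTLY**: every admissible Stage-9 parameter satisfying its provisos is a record of this module at some world, any window
`0 < γw ≤ θ.γ` (cf. `exists_world_isRecordOfRecord₉C`; the pin adds no proviso and no admissibility clause). [cite: Balaban1989LargeFieldII, Thm 1 + (0.1) pp.355–356 (bookkeeping)] -/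
theorem exists_world_isRecordOfRecord₉CB10 (θ : Stage9Params F N) (h : θ.Provisos) (hθ : θ.Admissible) {γw : ℝ}
    (hγw : 0 < γw ∧ γw ≤ θ.γ) : ∃ w : WorldP, IsRecordOfRecord₉CB10 F N (datumOfRecord₉ F N θ h) w ∧ w.γ = γw := by
  obtain ⟨w₀, -, -⟩ := exists_world_isRecordOfRecord₉C F N θ h hθ hγw
  exact ⟨{ w₀ with
      C := (datumOfRecord₉ F N θ h).C, γ := γw, L := (θ.L : ℝ), one_lt_L := by exact_mod_cast θ.hL.2,
      up := fun P => upOfRecord₅C F N ((θ.toStage5 F N).pinB10 F N) P },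
    ⟨θ, h, hθ, rfl, rfl, hγw, rfl, fun _ => rfl⟩, rfl⟩

variable {F N}
variable {D : FiniteEpsData F (SU N)} {w : WorldP}

/-- **Refinement `IsRecordOfRecord₉CB10 → IsRecordOfRecord₉C`** with THE SAME datum AND world (witness `θ.pinB10`, provisos transported). [cite: Balaban1985UV3, Thm 1 p.257 (bookkeeping)] -/
theorem isRecordOfRecord₉C_of_isRecordOfRecord₉CB10 (h : IsRecordOfRecord₉CB10 F N D w) : IsRecordOfRecord₉C F N D w := by
  obtain ⟨θ, hP, hθ, hD, hC, hγ, hL, hup⟩ := h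
  refine ⟨θ.pinB10 F N, hP.pinB10, hθ, ?_, hC, hγ, hL, fun P => ?_⟩
  · rw [datumOfRecord₉_pinB10]; exact hD
  · rw [Stage9Params.toStage5_pinB10]; exact hup P

/-- … hence every world-reading node theorem over `IsRecordOfRecord₉C` (and, through Stage 9's shadow, over `IsRecordOfRecord₅C`) holds at every record of
this module: the `atWorld` transfer. [cite: Balaban1989LargeFieldII, Thm 1 p.355 (bookkeeping)] -/
theorem atWorld_of_isRecordOfRecord₉CB10 {X : Dag.Leaves → Prop}
    (h₅ : ∀ (D : FiniteEpsData F (SU N)) (w : WorldP), IsRecordOfRecord₅C F N D w → ∀ P : B12.RunParams, X (leavesP w P))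
    (h : IsRecordOfRecord₉CB10 F N D w) (P : B12.RunParams) : X (leavesP w P) :=
  atWorld_of_isRecordOfRecord₉C h₅ (isRecordOfRecord₉C_of_isRecordOfRecord₉CB10 h) P

/-- Conversely, RE-BINDING a Stage-9 record's world by the pinned C-binding over the same parameters gives a record of this module with the SAME datum.
[cite: Balaban1985UV3, Thm 1 p.257 (bookkeeping)] -/
theorem isRecordOfRecord₉CB10_rebind_of_isRecordOfRecord₉C (h : IsRecordOfRecord₉C F N D w) :
    ∃ (θ : Stage9Params F N) (_ : θ.Provisos), θ.Admissible ∧ (∀ P, w.up P = upOfRecord₅C F N (θ.toStage5 F N) P) ∧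
      IsRecordOfRecord₉CB10 F N D { w with up := fun P => upOfRecord₅C F N ((θ.toStage5 F N).pinB10 F N) P } := by
  obtain ⟨θ, hP, hθ, hD, hC, hγ, hL, hup⟩ := h
  exact ⟨θ, hP, hθ, hup, θ, hP, hθ, hD, hC, hγ, hL, fun _ => rfl⟩

/-- **THE `b10` LEAF AT A RECORD OF THIS MODULE IS THE SLOT OF RECORD**, at every run, with `L` the world's block size. [cite: Balaban1985UV3, Thm 1 p.257 (compact reading) + Thm 2 p.272] -/
theorem leaf_b10_iff_of_isRecordOfRecord₉CB10 (h : IsRecordOfRecord₉CB10 F N D w) :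
    ∃ L : ℕ, (Odd L ∧ 1 < L) ∧ w.L = (L : ℝ) ∧ ∀ P : B12.RunParams, (leavesP w P).b10 ↔ PrintedUV3V N L := by
  obtain ⟨θ, -, -, -, -, -, hL, hup⟩ := h
  refine ⟨θ.L, θ.hL, hL, fun P => ?_⟩
  show (w.up P).b10 ↔ _
  rw [hup P]
  exact upOfRecord₅C_pinB10_b10_iff F N (θ.toStage5 F N) P

/-- **N08 · [Balaban1985UV3] AT EVERY RECORD OF THIS MODULE, FROM THE SLOT OF RECORD** (in-edges unused). [cite: Balaban1985UV3, Thm 1 p.257 (compact reading) + Thm 2 p.272] -/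
theorem b10_main_of_isRecordOfRecord₉CB10 (hUV : ∀ L : ℕ, Odd L → 1 < L → PrintedUV3V N L) (h : IsRecordOfRecord₉CB10 F N D w)
    (P : B12.RunParams) : Dag.B10_main (leavesP w P) := by
  obtain ⟨L, hL, -, hiff⟩ := leaf_b10_iff_of_isRecordOfRecord₉CB10 h
  exact fun _ _ _ _ _ _ => (hiff P).2 (hUV L hL.1 hL.2)

/-- **N08 at a record of this module, EXACTLY**: ⟺ «the in-edge leaves imply the slot of record at the world's block size». [cite: Balaban1985UV3, Thm 1 p.257 + Thm 2 p.272 (the node's shape `Dag.B10_main`, bookkeeping)] -/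
theorem b10_main_iff_of_isRecordOfRecord₉CB10 (h : IsRecordOfRecord₉CB10 F N D w) :
    ∃ L : ℕ, (Odd L ∧ 1 < L) ∧ w.L = (L : ℝ) ∧ ∀ P : B12.RunParams,
      (Dag.B10_main (leavesP w P) ↔
        ((leavesP w P).b5 → (leavesP w P).b6 → (leavesP w P).b7 → (leavesP w P).b8 → (leavesP w P).b9 → (leavesP w P).b11 →
          PrintedUV3V N L)) := by
  obtain ⟨L, hL, hwL, hiff⟩ := leaf_b10_iff_of_isRecordOfRecord₉CB10 h
  refine ⟨L, hL, hwL, fun P => ?_⟩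
  unfold Dag.B10_main
  rw [hiff P]

end Record9

end Literature.MathematicalPhysics.QuantumFieldTheory.Balaban1983to89.Node00

end
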